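import Summits.CriticalPhenomena.PercolationContinuityZ3.Theorems.Transplant.PlanarSkeletonFrmFromDefs
import Summits.CriticalPhenomena.PercolationContinuityZ3.Theorems.Transplant.SkelFrmFromBChoiceDefs3
import Summits.CriticalPhenomena.PercolationContinuityZ3.Theorems.Transplant.SkelFrmBChoiceDefs3
import Summits.CriticalPhenomena.PercolationContinuityZ3.Theorems.Transplant.SkelPhiCellsSmallMT
import HarnessLib
import Summits.CriticalPhenomena.PercolationContinuityZ3.Theorems.Transplant.SkelFrmBChoiceDefsT
/-!
# U-WAVE PORT (RULING D-U, lead g21 2026-08-26; WAVE-U-MANIFEST v3.0 row «SkelFrmBChoiceDefsT» ↦ «SkelFrmFromBChoiceDefsT») of the tree module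
# `Transplant/SkelFrmBChoiceDefsT` onto the carrier `PlanarSkeletonFrmFrom` (frames only, cylinders connected from width `ℓ₀` on)

ORIGINAL TITLE: N2 (frames-only node `SamePDropOfSkeletonFrm₁`, OPEN), WAVE 1 under (R-40): THE CHOICE FUNCTION OF RECORD OVER THE PER-AXIS-CAPPED STAGGERED CELLS

builds on p205010 (kernel theorem, internal audit signed; external expert review pending) — nothing in this file uses p205010; NOTHING is claimed about the
OPEN node U `SamePDropOfSkeletonFrmFrom₁` (nor U_s / the end state).  Lane `prim-bschramm`, seat `prim-hp-8 gen 53 (U-wave port pen; tool of record = p3-g26 port_u.py)`; helper file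
(`--supports stmt-CriticalPhenomena-4575 --as helper`).  PORT RULES r1–r4 of RULING D-U: declaration order and proof texts are those of the original,
byte-identical except (i) the carrier token `PlanarSkeletonFrm ↦ PlanarSkeletonFrmFrom` (binders, `namespace`/`end` lines, qualified names of twinned
declarations), (ii) carrier-FREE declarations of the original (φ-level `Skelφ…` blocks and namespace-only arithmetic residents) are NOT re-declared —
this file imports the original and `export`s the twin-free residents (POLICY T / treatment (m1)); residents whose statement mentions a twinned
constant are copied, (iii) every carrier-binding declaration keeps its explicit binder `(Φ : PlanarSkeletonFrmFrom G)` in its own signature (r2).  Docstrings and citations are the original's.  Manifest row idx 48 (level 9; flags verbatim|DEF-ROW); filed by the hp-8 lineage under RULING M-11 (family P-hp8).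
-/

noncomputable section

open scoped Classical

namespace Summit.CriticalPhenomena.PercolationContinuityZ3.Theorems.Transplant

open MeasureTheory Literature.Probability.Percolation Literature.Probability.LatticeModels SimpleGraph KNCells
open Literature.Barriers.CriticalPhenomena (HasExponentialGrowth)
open Literature.Probability.Percolation.KozmaNitzan.Cells (oth oth_oth)

namespace PlanarSkeletonFrmFrom

open SkelConc (Consts)
open BoxProdZ2 (ConcRadiiG)
open Skelφ (oriφ trφ)
open Skelφ.StepI (DataN DataNS OutNS)

namespace NegB

open Neg

/-! ## §1 The per-axis truncated creep and the staggered cells of record under (R-40) -/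

section Values

variable (κ : Consts) {V : Type} [DecidableEq V] [Countable V] {G : SimpleGraph V} [G.LocallyFinite] (Φ : PlanarSkeletonFrmFrom G) (t : V)
  (p : unitInterval) (D : DataNS V) (g f : ℕ) (c : Fin 2 → ℕ)

/-- **The PER-AXIS truncated creep** `cT i := min (c i) (r (oth i))` (the creep of a step along `i` is felt on the other coordinate, so it is capped by the OTHER
unit: `c 0 ≤ r 1 = K·s₁`, `c 1 ≤ r 0 = K·s₀`). [this work] -/
def cT (i : Fin 2) : ℕ := min (c i) ((fcellsA κ Φ t p D g f).r (oth i))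

/-- `cT i ≤ r (oth i)` and `cT i ≤ c i`. [folklore] -/
theorem cT_le (i : Fin 2) : cT κ Φ t p D g f c i ≤ (fcellsA κ Φ t p D g f).r (oth i) ∧ cT κ Φ t p D g f c i ≤ c i := ⟨min_le_right _ _, min_le_left _ _⟩

/-- **Under the ledger row `c i ≤ r (oth i)` the truncation is the identity**: `cT i = c i`. [folklore] -/
theorem cT_eq (h : ∀ i, c i ≤ (fcellsA κ Φ t p D g f).r (oth i)) (i : Fin 2) : cT κ Φ t p D g f c i = c i := min_eq_left (h i)

/-- Under N1's UNIFORM row `c i ≤ r j` (all `i, j`) the truncation is the identity as well. [folklore] -/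
theorem cT_eq' (h : ∀ i j, c i ≤ (fcellsA κ Φ t p D g f).r j) (i : Fin 2) : cT κ Φ t p D g f c i = c i := cT_eq κ Φ t p D g f c (fun i => h i (oth i)) i

/-- **THE STAGGERED CELLS OF RECORD OF THE N2 CHAIN UNDER (R-40)** (`PCells2T`, per-axis creep cap): the cells `fcellsA` of the (ζ′) chain with the per-axis truncated
creep `cT` toward the onward quadrant — total in the slot value `c`, and a GENUINE `PCells2T` (`c 0` may reach `K·s₁`). [cite: KozmaNitzan2024, §4 p. 25 (the renormalised lattice)] -/
def fcellsT : PCells2T where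
  toPCells2 := fcellsA κ Φ t p D g f
  c := fun i => ((cT κ Φ t p D g f c i : ℕ) : ℤ)
  hc0 := fun i => Int.natCast_nonneg _
  hcr := fun i => by exact_mod_cast (cT_le κ Φ t p D g f c i).1

/-- **The underlying two-unit cells are `fcellsA` (by `rfl`)** — hp-8 g42's (S5): every number row of the (ζ′)/(ζ″) ledger about `K`, `s`, `r`, and every cell-agnostic
face/value file stated over `fcellsA`, carries to the T function with no re-proof. [folklore] -/
@[simp] theorem fcellsT_toPCells2 : (fcellsT κ Φ t p D g f c).toPCells2 = fcellsA κ Φ t p D g f := rfl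

/-- `r` of the T-staggered cells is `fcellsA`'s (by `rfl`). [folklore] -/
theorem fcellsT_r (i : Fin 2) : (fcellsT κ Φ t p D g f c).r i = (fcellsA κ Φ t p D g f).r i := rfl

/-- `s` of the T-staggered cells (by `rfl`). [folklore] -/
theorem fcellsT_s (i : Fin 2) : (fcellsT κ Φ t p D g f c).s i = (fcellsA κ Φ t p D g f).s i := rfl

/-- `K` of the T-staggered cells (by `rfl`). [folklore] -/
theorem fcellsT_K : (fcellsT κ Φ t p D g f c).K = (fcellsA κ Φ t p D g f).K := rfl

/-- The creep field (by `rfl`). [folklore] -/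
theorem fcellsT_c (i : Fin 2) : (fcellsT κ Φ t p D g f c).c i = ((cT κ Φ t p D g f c i : ℕ) : ℤ) := rfl

/-- The creep is at most the slot value. [folklore] -/
theorem fcellsT_c_le (i : Fin 2) : (fcellsT κ Φ t p D g f c).c i ≤ c i := by
  rw [fcellsT_c]; exact_mod_cast (cT_le κ Φ t p D g f c i).2

/-- The creep is at most the other unit: `c i ≤ r (oth i)` (the structure row, by name). [folklore] -/
theorem fcellsT_c_le_r_oth (i : Fin 2) : (fcellsT κ Φ t p D g f c).c i ≤ ((fcellsA κ Φ t p D g f).r (oth i) : ℤ) := (fcellsT κ Φ t p D g f c).hcr i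

/-- **Under the ledger row `c i ≤ r (oth i)` the creep IS the slot value.** [folklore] -/
theorem fcellsT_c_eq (h : ∀ i, c i ≤ (fcellsA κ Φ t p D g f).r (oth i)) (i : Fin 2) : (fcellsT κ Φ t p D g f c).c i = c i := by
  rw [fcellsT_c, cT_eq κ Φ t p D g f c h]

/-- Under N1's uniform row `c i ≤ r j` the creep is the slot value as well. [folklore] -/
theorem fcellsT_c_eq' (h : ∀ i j, c i ≤ (fcellsA κ Φ t p D g f).r j) (i : Fin 2) : (fcellsT κ Φ t p D g f c).c i = c i :=
  fcellsT_c_eq κ Φ t p D g f c (fun i => h i (oth i)) i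

/-- With the zero slot value the T-staggered centre is the (ζ′) centre. [folklore] -/
theorem fcellsT_cenS_zero (v : Site 2) : (fcellsT κ Φ t p D g f 0).cenS v = (fcellsA κ Φ t p D g f).cen v :=
  PCells2T.cenS_eq_cen_of_zero _ (fun i => by rw [fcellsT_c]; simp [cT]) v

/-- The uniformly capped cells of p348247 embed into `PCells2T` with the same underlying cells (by `rfl`; a second `PCells2T` witness). [folklore] -/
theorem fcellsS_toT_toPCells2 : (fcellsS κ Φ t p D g f c).toT.toPCells2 = (fcellsT κ Φ t p D g f c).toPCells2 := rfl

/-- Under N1's uniform row both staggered centres agree (the S creep and the T creep are both the slot value). [folklore] -/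
theorem fcellsT_cenS_eq_of_uniform (h : ∀ i j, c i ≤ (fcellsA κ Φ t p D g f).r j) (v : Site 2) :
    (fcellsT κ Φ t p D g f c).cenS v = (fcellsS κ Φ t p D g f c).cenS v := by
  funext j
  rw [PCells2T.cenS_apply, PCells2S.cenS_apply, fcellsT_c_eq' κ Φ t p D g f c h, fcellsS_c_eq κ Φ t p D g f c h]
  rfl

/-! ## §2 The column slot at the T-staggered centre, the schedule, the arrival half-widths -/

/-- **The column slot of record, read at the T-STAGGERED centre**: `offNT x := NrepA (cenS x) + 1` (hp-8's `hcolQ` row `‖rep₂ (cenS x)‖₁ + 1 ≤ rQ a x`). [this work] -/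
def offNT : Site 2 → ℕ := fun x => NrepA κ Φ t p D g f ((fcellsT κ Φ t p D g f c).cenS x) + 1

/-- **The radius schedule of record over the T-staggered cells**: `schedOfT S := Prm.schedN S fcellsA offNT` (numbers over the underlying `PCells2`; the column slot at
`cenS`). [this work] -/
def schedOfT (S : Skelφ.Prm.SchedIn) : ConcRadiiG := Skelφ.Prm.schedN S (fcellsA κ Φ t p D g f) (offNT κ Φ t p D g f c)

/-- The schedule by name. [folklore] -/
theorem schedOfT_eq (S : Skelφ.Prm.SchedIn) : schedOfT κ Φ t p D g f c S = Skelφ.Prm.schedN S (fcellsA κ Φ t p D g f) (offNT κ Φ t p D g f c) := rfl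

/-- **`WFS2 (fcellsT …).toPCells2 (schedOfT S)`** for every input block and every slot value. [this work] -/
theorem schedOfT_WFS2 (S : Skelφ.Prm.SchedIn) : Skelφ.WFS2 (fcellsT κ Φ t p D g f c).toPCells2 (schedOfT κ Φ t p D g f c S) := Skelφ.Prm.schedN_WFS2 _ _ _

/-- **The column floor at the T-staggered centre**: `NrepA (cenS x) + 1 ≤ rQ a x`. [folklore] -/
theorem colQ_schedOfT (S : Skelφ.Prm.SchedIn) : ∀ a x, NrepA κ Φ t p D g f ((fcellsT κ Φ t p D g f c).cenS x) + 1 ≤ (schedOfT κ Φ t p D g f c S).rQ a x :=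
  fun a x => Skelφ.Prm.off_le_schedN_rQ S (fcellsA κ Φ t p D g f) (offNT κ Φ t p D g f c) a x

variable (b : Fin 2 → ℕ)

/-- **`bS i ≤ 3·r i`** (SmallMT's `Mb_subset_M` row `hb`), stated over the T-staggered cells, for EVERY slot value (`bS` is p348247's cell-agnostic truncation). [folklore] -/
theorem bS_leT (i : Fin 2) : bS κ Φ t p D g f b i ≤ 3 * (fcellsT κ Φ t p D g f c).r i := by
  rw [fcellsT_r]; exact min_le_right _ _

/-! ## §3 The scheme of record, the choices -/

variable (Pv : PSlot) (O : OutNS V) (gv fv : Neg.FSlot) (Sv : SSlot) (cv : CSlot) (bv : BSlot) (q : unitInterval)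

/-- `bOf ≤ 3r` over the T-staggered cells, for every slot value. [folklore] -/
theorem bOf_leT (i : Fin 2) :
    bOf κ Φ t p O gv fv bv i ≤ 3 * (fcellsT κ Φ t p O.merged (gOf κ Φ t p O gv) (fOf κ Φ t p O fv) (cOf κ Φ t p O gv fv cv)).r i :=
  bS_leT κ Φ t p O.merged _ _ _ _ i

/-- **THE SCHEME OF RECORD OF THE N2 CHAIN at `(O, q)` UNDER (R-40)**: `cellGeomSG₂bT` over the oriented (ζ′) fine map `fineOA`, the T-STAGGERED cells `fcellsT`, root
`t`, schedule `schedOfT (Sv …)`, arrival boxes `bOf` (slot `bv`, truncated at `3r`). [cite: KozmaNitzan2024, §4 pp. 25–27 (Q_v, M_v, E_{v,x}, H^j_{v,x})] -/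
def ΓQT : CellGeom V ℕ :=
  Skelφ.cellGeomSG₂bT G (fineOA κ Φ t p O.D O.DT.toDataN O.ori (gOf κ Φ t p O gv) (fOf κ Φ t p O fv))
    (fcellsT κ Φ t p O.merged (gOf κ Φ t p O gv) (fOf κ Φ t p O fv) (cOf κ Φ t p O gv fv cv)) t
    (schedOfT κ Φ t p O.merged (gOf κ Φ t p O gv) (fOf κ Φ t p O fv) (cOf κ Φ t p O gv fv cv)
      (Sv κ Φ t p O.merged (gOf κ Φ t p O gv) (fOf κ Φ t p O fv) q))
    (bOf κ Φ t p O gv fv bv)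

/-- **The face data of the N2 chain at `(O, q)` under (R-40)** (`faceDataSGT` over `fineOA`/`fcellsT`/`schedOfT`). [this work] -/
def FDQT : FaceData V ℕ :=
  Skelφ.faceDataSGT G (fineOA κ Φ t p O.D O.DT.toDataN O.ori (gOf κ Φ t p O gv) (fOf κ Φ t p O fv))
    (fcellsT κ Φ t p O.merged (gOf κ Φ t p O gv) (fOf κ Φ t p O fv) (cOf κ Φ t p O gv fv cv)) t
    (schedOfT κ Φ t p O.merged (gOf κ Φ t p O gv) (fOf κ Φ t p O fv) (cOf κ Φ t p O gv fv cv)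
      (Sv κ Φ t p O.merged (gOf κ Φ t p O gv) (fOf κ Φ t p O fv) q))

/-- **The level data of the N2 chain at `O` under (R-40)** (`levelDataST` over `fineOA`/`fcellsT`). [this work] -/
def LDQT : LevelData V ℕ :=
  Skelφ.levelDataST (fineOA κ Φ t p O.D O.DT.toDataN O.ori (gOf κ Φ t p O gv) (fOf κ Φ t p O fv))
    (fcellsT κ Φ t p O.merged (gOf κ Φ t p O gv) (fOf κ Φ t p O fv) (cOf κ Φ t p O gv fv cv))

/-- The root of the scheme of record is `t` (by `rfl`). [folklore] -/
@[simp] theorem ΓQT_root : (ΓQT κ Φ t p O gv fv Sv cv bv q).root = t := rfl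

/-- The base anchor of the scheme of record is `0` (by `rfl`). [folklore] -/
@[simp] theorem ΓQT_a₀ : (ΓQT κ Φ t p O gv fv Sv cv bv q).a₀ = 0 := rfl

/-- The number of stub levels of the scheme of record is the cells' `K` (by `rfl`). [folklore] -/
theorem ΓQT_K : (ΓQT κ Φ t p O gv fv Sv cv bv q).K = (fcellsA κ Φ t p O.merged (gOf κ Φ t p O gv) (fOf κ Φ t p O fv)).K := rfl

/-- **The arrival box of the scheme of record** (what the (C) residue's `hlastM` and the (R) root leg read): the window span over the SMALL box `Mb bOf v` about the
T-staggered centre, radius `rM a v` of `schedOfT`. [folklore] -/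
theorem ΓQT_M (a : ℕ) (v : Site 2) : (ΓQT κ Φ t p O gv fv Sv cv bv q).M a v =
    Skelφ.VWin G (fineOA κ Φ t p O.D O.DT.toDataN O.ori (gOf κ Φ t p O gv) (fOf κ Φ t p O fv)) t
      (PCells2T.Mb (fcellsT κ Φ t p O.merged (gOf κ Φ t p O gv) (fOf κ Φ t p O fv) (cOf κ Φ t p O gv fv cv)) (bOf κ Φ t p O gv fv bv) v)
      ((schedOfT κ Φ t p O.merged (gOf κ Φ t p O gv) (fOf κ Φ t p O fv) (cOf κ Φ t p O gv fv cv)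
        (Sv κ Φ t p O.merged (gOf κ Φ t p O gv) (fOf κ Φ t p O fv) q)).rM a v) := rfl

/-- **The cube of the scheme of record**: the window span over `Q v` about the T-staggered centre, radius `rQ a v`. [folklore] -/
theorem ΓQT_Q (a : ℕ) (v : Site 2) : (ΓQT κ Φ t p O gv fv Sv cv bv q).Q a v =
    Skelφ.VWin G (fineOA κ Φ t p O.D O.DT.toDataN O.ori (gOf κ Φ t p O gv) (fOf κ Φ t p O fv)) t
      ((fcellsT κ Φ t p O.merged (gOf κ Φ t p O gv) (fOf κ Φ t p O fv) (cOf κ Φ t p O gv fv cv)).Q v)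
      ((schedOfT κ Φ t p O.merged (gOf κ Φ t p O gv) (fOf κ Φ t p O fv) (cOf κ Φ t p O gv fv cv)
        (Sv κ Φ t p O.merged (gOf κ Φ t p O gv) (fOf κ Φ t p O fv) q)).rQ a v) := rfl

/-- The far region of the scheme of record: the window span over the slack two-block far region `FarNS₂ v δ` (about the T-staggered NEIGHBOUR), radius `rE a v δ`.
[folklore] -/
theorem ΓQT_Efar (a : ℕ) (v : Site 2) (δ : MDir) : (ΓQT κ Φ t p O gv fv Sv cv bv q).Efar a v δ =
    Skelφ.VWin G (fineOA κ Φ t p O.D O.DT.toDataN O.ori (gOf κ Φ t p O gv) (fOf κ Φ t p O fv)) t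
      ((fcellsT κ Φ t p O.merged (gOf κ Φ t p O gv) (fOf κ Φ t p O fv) (cOf κ Φ t p O gv fv cv)).FarNS₂ v δ)
      ((schedOfT κ Φ t p O.merged (gOf κ Φ t p O gv) (fOf κ Φ t p O fv) (cOf κ Φ t p O gv fv cv)
        (Sv κ Φ t p O.merged (gOf κ Φ t p O gv) (fOf κ Φ t p O fv) q)).rE a v δ) := rfl

/-- The admissible anchors of the scheme of record are `{a, a+1}` (by `rfl`). [folklore] -/
theorem ΓQT_anchSet (a : ℕ) (v : Site 2) : (ΓQT κ Φ t p O gv fv Sv cv bv q).anchSet a v = {a, a + 1} := rfl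

variable (hC : Φ.CylSubcritical p)

/-- **THE N2 CHOICES OF RECORD at `(κ, Φ, t, p)` UNDER (R-40), six slots, Step-I‴ accuracy at the CUBE** — `δI := δI3` ((R-33)), `m₀`, `Sz`, `SMn := SMnP` as in
p348247, `Γ := ΓQT`, `FD := FDQT`, `LD := LDQT`. [cite: KozmaNitzan2024, §4 Theorem 6 (pp. 25–31)] -/
def choiceAtQ3T : ChoiceNQ κ Φ t p hC where
  δI := δI3 κ Φ
  m₀ := Neg.m₀
  Sz := fun O => Neg.Sz O.merged
  SMn := fun O => SMnP κ Φ t p O.merged (gOf κ Φ t p O gv) (fOf κ Φ t p O fv) Pv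
  Γ := fun O q => ΓQT κ Φ t p O gv fv Sv cv bv q
  FD := fun O q => FDQT κ Φ t p O gv fv Sv cv q
  LD := fun O _ => LDQT κ Φ t p O gv fv cv
  δI_pos := δI3_pos κ Φ
  δI_lt_one := δI3_lt_one κ Φ
  S_adm := fun O _ => ⟨Neg.Sz_adm O.merged, SMnP_adm_at κ Φ t p O.merged _ _ Pv⟩

/-- The Step-I‴ accuracy of the T choices of record is `δI3` (by `rfl`). [folklore] -/
@[simp] theorem choiceAtQ3T_δI : (choiceAtQ3T κ Φ t p Pv gv fv Sv cv bv hC).δI = δI3 κ Φ := rfl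

/-- The least seed level is the landed one (by `rfl`). [folklore] -/
@[simp] theorem choiceAtQ3T_m₀ : (choiceAtQ3T κ Φ t p Pv gv fv Sv cv bv hC).m₀ = (choiceAtQ3 κ Φ t p Pv gv fv Sv cv bv hC).m₀ := rfl

/-- The zone sizes are the landed ones (by `rfl`). [folklore] -/
@[simp] theorem choiceAtQ3T_Sz : (choiceAtQ3T κ Φ t p Pv gv fv Sv cv bv hC).Sz = (choiceAtQ3 κ Φ t p Pv gv fv Sv cv bv hC).Sz := rfl

/-- The admissible pairs are the landed ones (by `rfl`; the pair slot `Pv` is read exactly as before). [folklore] -/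
@[simp] theorem choiceAtQ3T_SMn : (choiceAtQ3T κ Φ t p Pv gv fv Sv cv bv hC).SMn = (choiceAtQ3 κ Φ t p Pv gv fv Sv cv bv hC).SMn := rfl

/-- The anchored cells are `ΓQT` (by `rfl`). [folklore] -/
@[simp] theorem choiceAtQ3T_Γ (O : OutNS V) (q : unitInterval) : (choiceAtQ3T κ Φ t p Pv gv fv Sv cv bv hC).Γ O q = ΓQT κ Φ t p O gv fv Sv cv bv q := rfl

/-- The face data are `FDQT` (by `rfl`). [folklore] -/
@[simp] theorem choiceAtQ3T_FD (O : OutNS V) (q : unitInterval) : (choiceAtQ3T κ Φ t p Pv gv fv Sv cv bv hC).FD O q = FDQT κ Φ t p O gv fv Sv cv q := rfl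

/-- The level data are `LDQT` (by `rfl`). [folklore] -/
@[simp] theorem choiceAtQ3T_LD (O : OutNS V) (q : unitInterval) : (choiceAtQ3T κ Φ t p Pv gv fv Sv cv bv hC).LD O q = LDQT κ Φ t p O gv fv cv := rfl

/-- The scheme of the T choices of record at `(O, q)` is `⟨ΓQT, q, κ.δ⟩` (by `rfl`). [folklore] -/
theorem choiceAtQ3T_scheme (O : OutNS V) (q : unitInterval) :
    (choiceAtQ3T κ Φ t p Pv gv fv Sv cv bv hC).scheme O q = ⟨ΓQT κ Φ t p O gv fv Sv cv bv q, q, κ.δ⟩ := rfl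

end Values

end NegB

/-! ## §4 The choice function of record under (R-40) -/

/-- **THE CHOICE FUNCTION OF RECORD OF THE FRAMES-ONLY NODE UNDER (R-40), six slots, Step-I‴ accuracy at the cube** (box `gv`, width `fv`, extra pairs `Pv`, fibre
block `Sv`, creep `cv`, arrival box `bv`; cells `PCells2T`, scheme `cellGeomSG₂bT`): the `ChoiceFnNQ` the four wrappers and the node₂ file meet (closure
`samePDropOfSkeletonFrm₁_of_choiceFnNQLT`). [cite: KozmaNitzan2024, §4 Theorem 6 (pp. 25–31)] -/
def frmChoiceAllQ3T (gv fv : Neg.FSlot) (Pv : NegB.PSlot) (Sv : NegB.SSlot) (cv : NegB.CSlot) (bv : NegB.BSlot) : ChoiceFnNQ :=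
  fun κ _ _ _ _ _ Φ _ t _ _ p _ _ hC => NegB.choiceAtQ3T κ Φ t p Pv gv fv Sv cv bv hC

/-- `frmChoiceAllQ3T` unfolds to `NegB.choiceAtQ3T` (by `rfl`). [folklore] -/
theorem frmChoiceAllQ3T_eq (gv fv : Neg.FSlot) (Pv : NegB.PSlot) (Sv : NegB.SSlot) (cv : NegB.CSlot) (bv : NegB.BSlot) (κ : Consts) {V : Type} [DecidableEq V]
    [Countable V] (G : SimpleGraph V) [G.LocallyFinite] (Φ : PlanarSkeletonFrmFrom G) (hg : ¬ HasExponentialGrowth G) (t : V) (ht : t ∈ Φ.types) (h1 : Φ.types = {t})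
    (p : unitInterval) (hp0 : 0 < (p : ℝ)) (hp1 : (p : ℝ) < 1) (hC : Φ.CylSubcritical p) :
    frmChoiceAllQ3T gv fv Pv Sv cv bv κ G Φ hg t ht h1 p hp0 hp1 hC = NegB.choiceAtQ3T κ Φ t p Pv gv fv Sv cv bv hC := rfl

/-- The scheme of the choice function of record at `(O, q)` is `⟨ΓQT, q, κ.δ⟩` (by `rfl`) — the form the (R)/(F)/(C) wrappers read. [folklore] -/
theorem frmChoiceAllQ3T_scheme (gv fv : Neg.FSlot) (Pv : NegB.PSlot) (Sv : NegB.SSlot) (cv : NegB.CSlot) (bv : NegB.BSlot) (κ : Consts) {V : Type} [DecidableEq V]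
    [Countable V] (G : SimpleGraph V) [G.LocallyFinite] (Φ : PlanarSkeletonFrmFrom G) (hg : ¬ HasExponentialGrowth G) (t : V) (ht : t ∈ Φ.types) (h1 : Φ.types = {t})
    (p : unitInterval) (hp0 : 0 < (p : ℝ)) (hp1 : (p : ℝ) < 1) (hC : Φ.CylSubcritical p) (O : Skelφ.StepI.OutNS V) (q : unitInterval) :
    (frmChoiceAllQ3T gv fv Pv Sv cv bv κ G Φ hg t ht h1 p hp0 hp1 hC).scheme O q = ⟨NegB.ΓQT κ Φ t p O gv fv Sv cv bv q, q, κ.δ⟩ := rfl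

end PlanarSkeletonFrmFrom

end Summit.CriticalPhenomena.PercolationContinuityZ3.Theorems.Transplant

end
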